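import Literature.AlgebraicGeometry.Crystalline.StaircaseIntegralDegeneration
import Literature.AlgebraicGeometry.Crystalline.SheafHypercohomology
import HarnessLib

/-!
# Torsion-free hypercohomology of the truncated staircase de Rham complexes: instance-free forms

Companions to `Crystalline/StaircaseIntegralDegeneration` for the consumers of the `hu` line of the
crux `FormalLiftingFromClassLifting` (route `HodgeConjecture/PadicSemiregularLift`), whose lattice
lemmas take as input the `p`-torsion-freeness of the hypercohomology groups
`ℍⁿ(𝒳, σ≤(r-1)(p^{(r-•)M}Ω•_{𝒳/W}))` (`Crystalline.SheafHypercohomology` of the truncation below `r`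
of the `ℤ`-extended staircase de Rham complex `Crystalline.deRhamStaircaseInt 𝒳 p r M =
(powImage Ω• p ((r-•)M)).extend`, `Crystalline/HuComplexesPresentation`):

* `hasHyperExt_constantSheafInt_single` — the smallness instance `HasHyperExt ℤ Y[-n]` for a
  single complex of abelian sheaves (bounded below), discharging the instance hypothesis `[hA]`
  under which `StaircaseIntegralDegeneration` is stated;
* `sheafHypercohomology_staircaseTrunc_torsionFree` — granted Deligne's degeneration modulo
  torsion (`hdeg : HodgeDeRhamDegeneratesModTorsion`), for `𝒳/W(k)` a smooth proper model of
  relative dimension `d` with `Hᵇ(𝒳, 𝒪)`, `Hᵇ(𝒳, Ω¹)` `p`-torsion-free and `d ≤ 3 ∨ Ω¹ ≅ 𝒪^d`,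
  every `ℍⁿ(σ≤(r-1)(p^{(r-•)M}Ω•))` with `r < d` is torsion-free (all `M`, all `n`) — the
  hypothesis-free restatement of `staircase_torsionFree_hyperExt_stupidTruncLE_weight`;
* `stupidFiltration_delta_eq_zero_of_neg` (abstract) — the connecting maps of the stupid
  filtration below the support of a complex in degrees `≥ 0` vanish;
* `staircase_torsionFree_hyperExt_stupidTruncLE_zero` — WEIGHT ONE NEEDS NO DEGENERATION: the
  truncation `σ≤0(p^{e}Ω•) = (p^{e 0}𝒪)[0]` has one column, so its hypercohomology is torsion-free
  from the torsion-freeness of `Hᵇ(𝒳, 𝒪)` alone (no `hdeg`); hence for relative surfaces (`d = 2`,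
  only `r = 1 < d`) the `hu` line uses no Hodge–de Rham degeneration.

[folklore] Everything here is proved; `hdeg` enters only the second result, as a hypothesis.
-/

noncomputable section

universe w v u

set_option synthInstance.maxHeartbeats 200000

namespace Literature.Algebra.Homology

open CategoryTheory Limits

/-- Below the support there is nothing to connect: for `K` strictly in degrees `≥ 0` and `n₀ < 0`
the connecting map `δ : HyperExt A (σ≤n₀ K) k → HyperExt A (Kⁿ¹[-n₁]) k'` of the stupid filtration
vanishes (its source is zero). [folklore] -/
theorem stupidFiltration_delta_eq_zero_of_neg {C : Type u} [Category.{v} C] [Abelian C]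
    [HasExt.{w} C] (A : C)
    [hA : ∀ (n : ℤ) (Y : C), HasHyperExt.{w} A ((CochainComplex.singleFunctor C n).obj Y)]
    (K : CochainComplex C ℤ) [K.IsStrictlyGE 0] (n₀ n₁ : ℤ) (h : n₀ + 1 = n₁) (k k' : ℤ)
    (hk : k + 1 = k') (hn : n₀ < 0) :
    HyperExt.delta (X := A) (shortExact_stupidFiltration K n₀ n₁ h) k k' hk = 0 := by
  ext x
  obtain rfl : x = 0 := hyperExt_stupidTruncLE_eq_zero_of_neg A K n₀ hn k x
  rw [map_zero, AddMonoidHom.zero_apply]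

end Literature.Algebra.Homology

namespace Literature.AlgebraicGeometry.Crystalline

open CategoryTheory CategoryTheory.Limits _root_.AlgebraicGeometry _root_.TopologicalSpace
open Literature.AlgebraicGeometry.Motives Literature.AlgebraicGeometry.Motives.WittScheme
open Literature.Algebra.Homology

variable {p : ℕ} [Fact p.Prime] {k : Type} [Field k] [CharP k p] {d : ℕ}

omit [CharP k p] in
/-- Hyper-Ext from the constant sheaf `ℤ` into a single complex `Y[-n]` of abelian sheaves on `|𝒳|`
is defined (smallness): `Y[-n]` is bounded below. [folklore] -/
theorem hasHyperExt_constantSheafInt_single (𝒳 : SchemeOver (WittVector p k)) (n : ℤ)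
    (Y : Sheaf (Opens.grothendieckTopology 𝒳.left) AddCommGrpCat.{0}) :
    HasHyperExt.{0} (constantSheafInt (Opens.grothendieckTopology 𝒳.left))
      ((CochainComplex.singleFunctor _ n).obj Y) :=
  hasHyperExt_of_isGE _ _ n

/-- **Torsion-free hypercohomology of `σ≤(r-1)(p^{(r-•)M}Ω•)` for `r < d`, all levels `M` and all
degrees** (granted `hdeg`), in the tree's `SheafHypercohomology` form and free of instance
hypotheses. [cite: Deligne1968, Thm. 5.5 (ii)] -/
theorem sheafHypercohomology_staircaseTrunc_torsionFree (hdeg : HodgeDeRhamDegeneratesModTorsion)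
    (𝒳 : SchemeOver (WittVector p k)) (h𝒳 : IsSmoothProperModel d 𝒳)
    (hO : ∀ (b : ℕ) (x : structureSheafCohomology 𝒳.left b), (p : ℤ) • x = 0 → x = 0)
    (hΩ : ∀ (b : ℕ) (x : hodgeCohomologyOne 𝒳 b), (p : ℤ) • x = 0 → x = 0)
    (hdisj : d ≤ 3 ∨ Nonempty (cotangentSheaf 𝒳 ≅
      SheafOfModules.free (R := 𝒳.left.ringCatSheaf) (Fin d)))
    (r M : ℕ) (hrd : r < d) (n : ℤ) {m : ℤ} (hm : m ≠ 0)
    (x : SheafHypercohomology.{0} (Opens.grothendieckTopology 𝒳.left)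
      (stupidTruncLE ((powImage (algebraicDeRhamComplex 𝒳) (p : ℤ) (antitone_staircase r M)).extend
        ComplexShape.embeddingUpNat) ((r : ℤ) - 1)) n)
    (hx : m • x = 0) : x = 0 :=
  staircase_torsionFree_hyperExt_stupidTruncLE_weight 𝒳 hdeg
    (hA := hasHyperExt_constantSheafInt_single 𝒳) h𝒳 hO hΩ hdisj r M hrd n m hm x hx

/-- **Column zero needs only `Hᵇ(𝒳, 𝒪)`.** For `𝒳/W(k)` a smooth proper model and any antitone
`e`, the hyper-Ext `HyperExt ℤ ((p^{e}Ω•)⁰)[0] k` has no `m`-torsion (`m ≠ 0`) as soon as every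
`Hᵇ(𝒳, 𝒪)` has no `p`-torsion: `(p^{e}Ω•)⁰ ≅ 𝒪` (`powImageXIso`, `p^{e 0}` being a monomorphism) and
prime-to-`p` integers act bijectively. [folklore] -/
theorem staircase_torsionFree_hyperExt_single_zero (𝒳 : SchemeOver (WittVector p k))
    {e : ℕ → ℕ} (he : Antitone e)
    [hA : ∀ (n : ℤ) (Y : Sheaf (Opens.grothendieckTopology 𝒳.left) AddCommGrpCat.{0}),
      HasHyperExt.{0} (constantSheafInt (Opens.grothendieckTopology 𝒳.left))
        ((CochainComplex.singleFunctor _ n).obj Y)]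
    (h𝒳 : IsSmoothProperModel d 𝒳)
    (hO : ∀ (b : ℕ) (x : structureSheafCohomology 𝒳.left b), (p : ℤ) • x = 0 → x = 0)
    {m : ℤ} (hm : m ≠ 0) (n k₀ : ℤ) (hn : n ≤ 0)
    (x : HyperExt.{0} (constantSheafInt (Opens.grothendieckTopology 𝒳.left))
      ((CochainComplex.singleFunctor _ n).obj
        (((powImage (algebraicDeRhamComplex 𝒳) (p : ℤ) he).extend
          ComplexShape.embeddingUpNat).X n)) k₀)
    (hx : m • x = 0) : x = 0 := by
  refine torsionFree_hyperExt_single_extend _ (powImage (algebraicDeRhamComplex 𝒳) (p : ℤ) he)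
    (fun (n _ : ℤ) => n ≤ 0) m (fun j b hj y hy => ?_) n k₀ hn x hx
  have hj' : (j : ℤ) ≤ 0 := hj
  obtain rfl : j = 0 := by omega
  haveI := IsSmoothProperModel.mono_p_smul_id_algebraicDeRhamComplex_X 𝒳 d h𝒳 0
  have htf := torsionFree_H_algebraicDeRhamComplex_X_of_pTorsionFree 𝒳 0 b
    (H_algebraicDeRhamComplex_X_zero_torsionFree 𝒳 (hO b)) hm
  exact Ext.torsionFree_of_iso (powImageXIso (algebraicDeRhamComplex 𝒳) (p : ℤ) he 0).symm htf y hy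

/-- **Weight one needs no degeneration.** For `𝒳/W(k)` a smooth proper model whose `Hᵇ(𝒳, 𝒪)` have
no `p`-torsion and any antitone `e`, the truncation `σ≤0(p^{e}Ω•) = ((p^{e}Ω•)⁰)[0] ≅ 𝒪[0]` has a
single column, so its hypercohomology `ℍⁿ(𝒳, σ≤0(p^{e}Ω•))` is torsion-free — no Hodge–de Rham
degeneration and no hypothesis on `Ω¹` is used (the case `r = 1` of the lattice inputs of the `hu`
line; for relative surfaces, `d = 2`, it is the only weight below `d`). [folklore] -/
theorem staircase_torsionFree_hyperExt_stupidTruncLE_zero (𝒳 : SchemeOver (WittVector p k))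
    {e : ℕ → ℕ} (he : Antitone e) (h𝒳 : IsSmoothProperModel d 𝒳)
    (hO : ∀ (b : ℕ) (x : structureSheafCohomology 𝒳.left b), (p : ℤ) • x = 0 → x = 0)
    (n : ℤ) {m : ℤ} (hm : m ≠ 0)
    (x : SheafHypercohomology.{0} (Opens.grothendieckTopology 𝒳.left)
      (stupidTruncLE ((powImage (algebraicDeRhamComplex 𝒳) (p : ℤ) he).extend
        ComplexShape.embeddingUpNat) 0) n)
    (hx : m • x = 0) : x = 0 := by
  haveI := hasHyperExt_constantSheafInt_single 𝒳
  refine torsionFree_hyperExt_stupidTruncLE_of_le _ _ 0 (fun n₀ n₁ h k k' hk hn₁ => ?_)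
    (fun n' k' m' hn' hm' y hy => ?_) 0 n m le_rfl hm x hx
  · exact stupidFiltration_delta_eq_zero_of_neg _ _ n₀ n₁ h k k' hk (by omega)
  · exact staircase_torsionFree_hyperExt_single_zero 𝒳 he h𝒳 hO hm' n' k' hn' y hy

/-- The weight-one form at level `M`: `ℍⁿ(𝒳, σ≤0(p^{(1-•)M}Ω•))` is torsion-free for a smooth proper
model with `p`-torsion-free `Hᵇ(𝒳, 𝒪)` (no `hdeg`). [folklore] -/
theorem sheafHypercohomology_staircaseTrunc_one_torsionFree (𝒳 : SchemeOver (WittVector p k))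
    (h𝒳 : IsSmoothProperModel d 𝒳)
    (hO : ∀ (b : ℕ) (x : structureSheafCohomology 𝒳.left b), (p : ℤ) • x = 0 → x = 0)
    (M : ℕ) (n : ℤ) {m : ℤ} (hm : m ≠ 0)
    (x : SheafHypercohomology.{0} (Opens.grothendieckTopology 𝒳.left)
      (stupidTruncLE ((powImage (algebraicDeRhamComplex 𝒳) (p : ℤ) (antitone_staircase 1 M)).extend
        ComplexShape.embeddingUpNat) ((1 : ℕ) - 1 : ℤ)) n)
    (hx : m • x = 0) : x = 0 :=
  staircase_torsionFree_hyperExt_stupidTruncLE_zero 𝒳 (antitone_staircase 1 M) h𝒳 hO n hm x hx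

end Literature.AlgebraicGeometry.Crystalline

end
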